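import Summits.BirchSwinnertonDyer.BirchSwinnertonDyer.Theorems.ClassRecordThreeEulerHalvesAtThreeCartanCoverPrintClausesQuotientSurface
import Literature.NumberTheory.Automorphic.FuchsianEichlerShimuraWeightTwo
import HarnessLib

/-!
# Crux NUM `CartanOnePlaceDegreeLawAtThree` (item 24801), line `lattice` — the print clauses VIII: ES-SURJECTIVITY DESCENDS from the principal level `Γ̄(q)` to the
# cover group `ι(O₀'¹)` (averaging over the finite quotient `ι(O₀'¹) ∕ Γ̄(q)`)

Seat `bsd-stepL-tam3-p1` g29 (LEAD of crux 24801; `--supports stmt-BirchSwinnertonDyer-24801 --as helper`). Brick E6 (the last step) of the LEAD's in-tree route to the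
SURJECTIVITY half of (ESᶜ) `eichlerShimura_weightTwo_rePeriod` for the cover groups at `D > 1`: once every additive real cochain on the torsion-free principal level
`Γ̄(q) = CartanCover.principalLevel X q` is the real period cochain of a weight-two form on `Γ̄(q)` (E3–E5: `Γ̄(q)∖ℍ` is a compact Riemann surface —
`…PrintClausesQuotientSurface` — whose holomorphic differentials have prescribed real periods, `RiemannSurface.existsUnique_re_period_eq`), the same holds on the cover
group `Γ' = ι(O₀'¹) = CartanCover.coverUnits X q`:

* §1 `Γ̄(q)` has FINITE INDEX in `Γ'` (`finiteIndex_principalLevel_subgroupOf`, from `exists_finset_leftCosets_principalLevel`) and is NORMAL there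
  (`normal_principalLevel_subgroupOf`, from the tree's `conjAct_smul_principalLevel`); the cusps of `Γ'` are cusps of `Γ̄(q)` (Mathlib `IsCusp.of_isFiniteRelIndex`).
* §2 AVERAGING: for `F₁ ∈ S₂(Γ̄(q))`, `avg F₁ = Σ_{c ∈ Γ'∕Γ̄(q)} ρ(c) F₁` (`ρ = CartanCover.coverRep`, the slash action `F ↦ F ∣[2] g⁻¹` of `Γ'` on `S₂(Γ̄(q))`, trivial on `Γ̄(q)`) is
  `Γ'`-invariant (`coverRep_avg`), hence a weight-two cusp form ON `Γ'` (`liftAvg`).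
* §3 PERIODS: `Re ∫_{z₀}^{γ z₀} ρ(g) F₁ = Re ∫_{z₀}^{(g⁻¹γg) z₀} F₁` for `γ ∈ Γ̄(q)` (substitution `segmentIntegral_slash_eq` + base-point independence), so if the real periods of
  `F₁` are `u|Γ̄(q)` for an ADDITIVE `u : Γ' → ℝ` (conjugation-invariant!) then those of `liftAvg F₁` are `[Γ' : Γ̄(q)] · u` on `Γ̄(q)`, and — `γ^{[Γ':Γ̄(q)]} ∈ Γ̄(q)`,
  periods additive — on all of `Γ'` after dividing by the index: **`esSurj_coverUnits_of_esSurj_principalLevel`**.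

Theorems only (plus no new named facts); nothing about NUM or any curve is proved; BSD is proved for no curve.
[cite: ShimuraIATAF1971, Thm. 8.4 p. 234 and §8.1 (8.1.2)–(8.1.3) (res ∕ transfer between Γ and a subgroup of finite index)] [cite: KohenPacetti2016, §2 (arXiv:1403.7801v3 pp. 7–8)]
-/

set_option linter.dupNamespace false
set_option autoImplicit false

noncomputable section

open scoped MatrixGroups ModularForm Pointwise
open Function Set

namespace Summit.BirchSwinnertonDyer.BirchSwinnertonDyer.Theorems.CartanCover.PrintClauses

open Literature.NumberTheory.Automorphic

variable {D M : ℕ} {C : Finset ℕ} (X : CartanLevelCurveData D M C) (q : ℕ)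

/-! ## §1 `Γ̄(q)` is a normal subgroup of finite index of the cover group -/

/-- **`Γ̄(q)` has finite index in `ι(O₀'¹)`** (finitely many cosets, `exists_finset_leftCosets_principalLevel`). [cite: VignerasLNM800, Ch. IV §1] -/
theorem finiteIndex_principalLevel_subgroupOf (hq0 : q ≠ 0) : ((principalLevel X q).subgroupOf (coverUnits X q)).FiniteIndex := by
  classical
  obtain ⟨T, hT, hcos⟩ := exists_finset_leftCosets_principalLevel X q hq0
  let f : T → coverUnits X q ⧸ (principalLevel X q).subgroupOf (coverUnits X q) :=
    fun t => QuotientGroup.mk ⟨(t : GL (Fin 2) ℝ), hT t t.2⟩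
  have hf : Function.Surjective f := by
    intro c
    induction c using QuotientGroup.induction_on with
    | H γ =>
      obtain ⟨t, ht, htγ⟩ := hcos γ γ.2
      refine ⟨⟨t, ht⟩, QuotientGroup.eq.mpr ?_⟩
      rw [Subgroup.mem_subgroupOf]
      simpa using htγ
  haveI : Finite (coverUnits X q ⧸ (principalLevel X q).subgroupOf (coverUnits X q)) := Finite.of_surjective f hf
  exact Subgroup.finiteIndex_of_finite_quotient

/-- `Γ̄(q)` has finite relative index in `ι(O₀'¹)` (Mathlib's `IsFiniteRelIndex`). [cite: VignerasLNM800, Ch. IV §1] -/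
theorem isFiniteRelIndex_principalLevel (hq0 : q ≠ 0) : (principalLevel X q).IsFiniteRelIndex (coverUnits X q) :=
  ⟨(finiteIndex_principalLevel_subgroupOf X q hq0).index_ne_zero⟩

/-- **`Γ̄(q)` is normal in `ι(O₀'¹)`** (as a subgroup of the cover group; tree `conjAct_smul_principalLevel`). [cite: KohenPacetti2016, §2] -/
theorem normal_principalLevel_subgroupOf : ((principalLevel X q).subgroupOf (coverUnits X q)).Normal := by
  refine ⟨fun h hh g => ?_⟩
  rw [Subgroup.mem_subgroupOf] at hh ⊢
  have hconj := conjAct_smul_principalLevel X q g.2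
  -- `g h g⁻¹ ∈ g • Γ̄(q) = Γ̄(q)`
  have hmem : (g : GL (Fin 2) ℝ) * h * (g : GL (Fin 2) ℝ)⁻¹ ∈ ConjAct.toConjAct (g : GL (Fin 2) ℝ) • principalLevel X q := by
    rw [Subgroup.mem_pointwise_smul_iff_inv_smul_mem, ← ConjAct.toConjAct_inv, ConjAct.toConjAct_smul]
    simpa [mul_assoc] using hh
  rw [hconj] at hmem
  simpa using hmem

/-- A cusp of the cover group is a cusp of `Γ̄(q)`. [folklore] -/
theorem isCusp_principalLevel_of_isCusp_coverUnits (hq0 : q ≠ 0) {c : OnePoint ℝ} (hc : IsCusp c (coverUnits X q)) :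
    IsCusp c (principalLevel X q) := by
  haveI := isFiniteRelIndex_principalLevel X q hq0
  exact hc.of_isFiniteRelIndex

/-! ## §2 Averaging a form on `Γ̄(q)` over `ι(O₀'¹) ∕ Γ̄(q)` -/

section Averaging

variable {X q}

/-- The finite quotient `ι(O₀'¹) ∕ Γ̄(q)` as a `Fintype` (given `q ≠ 0`). -/
@[reducible] private def quotFintype (hq0 : q ≠ 0) : Fintype (coverUnits X q ⧸ (principalLevel X q).subgroupOf (coverUnits X q)) := by
  haveI := finiteIndex_principalLevel_subgroupOf X q hq0
  haveI : Finite (coverUnits X q ⧸ (principalLevel X q).subgroupOf (coverUnits X q)) := Subgroup.finite_quotient_of_finiteIndex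
  exact Fintype.ofFinite _

/-- `ρ(g k) F = ρ(g) F` for `k ∈ Γ̄(q)` (the principal level acts trivially). -/
theorem coverRep_mul_of_mem (g k : coverUnits X q) (hk : (k : GL (Fin 2) ℝ) ∈ principalLevel X q) (F : CuspForm (principalLevel X q) 2) :
    coverRep X q (g * k) F = coverRep X q g F := by
  rw [map_mul, Module.End.mul_apply, coverRep_eq_self_of_mem X q k hk]

/-- **The average `Σ_{c ∈ Γ'∕Γ̄(q)} ρ(c) F₁`** of a form on `Γ̄(q)` over coset representatives (any choice; `Quotient.out`). [cite: ShimuraIATAF1971, §8.1 (8.1.3) (transfer)] -/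
def avg (hq0 : q ≠ 0) (F : CuspForm (principalLevel X q) 2) : CuspForm (principalLevel X q) 2 :=
  haveI := quotFintype (X := X) hq0
  ∑ c : coverUnits X q ⧸ (principalLevel X q).subgroupOf (coverUnits X q), coverRep X q c.out F

/-- **The average is `Γ'`-invariant**: `ρ(g) (avg F) = avg F` (left multiplication by `g` permutes the cosets; representatives change by elements of `Γ̄(q)`,
which act trivially). [cite: ShimuraIATAF1971, §8.1 (8.1.3)] -/
theorem coverRep_avg (hq0 : q ≠ 0) (F : CuspForm (principalLevel X q) 2) (g : coverUnits X q) : coverRep X q g (avg hq0 F) = avg hq0 F := by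
  classical
  letI := quotFintype (X := X) hq0
  unfold avg
  rw [map_sum]
  -- each summand: `ρ(g) ρ(c.out) F = ρ((g • c).out) F`
  have hterm : ∀ c : coverUnits X q ⧸ (principalLevel X q).subgroupOf (coverUnits X q),
      coverRep X q g (coverRep X q c.out F) = coverRep X q (g • c).out F := by
    intro c
    rw [← Module.End.mul_apply, ← map_mul]
    -- `(g • c).out = g * c.out * k` with `k ∈ Γ̄(q)`
    have h1 : (QuotientGroup.mk (g * c.out) : coverUnits X q ⧸ (principalLevel X q).subgroupOf (coverUnits X q)) = g • c := by
      conv_rhs => rw [← QuotientGroup.out_eq' c]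
      rfl
    have h2 : (g * c.out)⁻¹ * (g • c).out ∈ (principalLevel X q).subgroupOf (coverUnits X q) := by
      rw [← QuotientGroup.eq, h1, QuotientGroup.out_eq']
    rw [Subgroup.mem_subgroupOf] at h2
    have h3 : (g • c).out = (g * c.out) * ((g * c.out)⁻¹ * (g • c).out) := by group
    rw [h3, coverRep_mul_of_mem _ _ h2]
  simp_rw [hterm]
  exact Fintype.sum_equiv (MulAction.toPerm g) _ _ fun c => rfl

/-- The averaged function is invariant under the slash action of the whole cover group. -/
theorem slash_avg (hq0 : q ≠ 0) (F : CuspForm (principalLevel X q) 2) {g : GL (Fin 2) ℝ} (hg : g ∈ coverUnits X q) :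
    (⇑(avg hq0 F)) ∣[(2 : ℤ)] g = ⇑(avg hq0 F) := by
  have h := coverRep_avg hq0 F ⟨g⁻¹, (coverUnits X q).inv_mem hg⟩
  rw [coverRep_apply] at h
  have h2 := congrArg (fun G : CuspForm (principalLevel X q) 2 => (⇑G : UpperHalfPlane → ℂ)) h
  simp only [coe_coverSlash, inv_inv] at h2
  exact h2

/-- **The average as a weight-two cusp form ON THE COVER GROUP `ι(O₀'¹)`** (its cusps are cusps of `Γ̄(q)`). [cite: ShimuraIATAF1971, §8.1 (8.1.3)] -/
def liftAvg (hq0 : q ≠ 0) (F : CuspForm (principalLevel X q) 2) : CuspForm (coverUnits X q) 2 where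
  toFun := ⇑(avg hq0 F)
  slash_action_eq' := fun _ hg => slash_avg hq0 F hg
  holo' := (avg hq0 F).holo'
  zero_at_cusps' := fun hc => (avg hq0 F).zero_at_cusps' (isCusp_principalLevel_of_isCusp_coverUnits X q hq0 hc)

/-- The lifted form has the same underlying function. -/
@[simp] theorem coe_liftAvg (hq0 : q ≠ 0) (F : CuspForm (principalLevel X q) 2) : ⇑(liftAvg hq0 F) = ⇑(avg hq0 F) := rfl

end Averaging

/-! ## §3 Periods of the average; ES-surjectivity descends -/

section Periods

variable {X q}

/-- Elements of the cover group have determinant `1`, hence positive determinant. -/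
private theorem det_pos_of_mem_coverUnits {g : GL (Fin 2) ℝ} (hg : g ∈ coverUnits X q) : 0 < g.det.val := by
  have h : g.det = 1 := hg.2.2
  rw [h, Units.val_one]; exact one_pos

/-- Base-point independence of the periods of a form on `Γ̄(q)`: `∫_w^{δ w} F = ∫_{z₀}^{δ z₀} F` for `δ ∈ Γ̄(q)`. [cite: ShimuraIATAF1971, §8.2 (8.2.19)–(8.2.20)] -/
private theorem period_indep (F : CuspForm (principalLevel X q) 2) {δ : GL (Fin 2) ℝ} (hδ : δ ∈ principalLevel X q) (z₀ w : UpperHalfPlane) :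
    segmentIntegral F w (δ • w) = segmentIntegral F z₀ (δ • z₀) := by
  have hdet : 0 < δ.det.val := by rw [Subgroup.HasDetOne.det_eq hδ, Units.val_one]; exact one_pos
  have hinv : segmentIntegral F (δ • z₀) (δ • w) = segmentIntegral F z₀ w := by
    rw [← segmentIntegral_slash_eq F hdet z₀ w, SlashInvariantForm.slash_action_eqn F δ hδ]
  have e1 := segmentIntegral_sub_segmentIntegral F z₀ w (δ • w)
  have e2 := segmentIntegral_sub_segmentIntegral F z₀ (δ • z₀) (δ • w)
  linear_combination (-1 : ℂ) * e1 + e2 + hinv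

/-- **Period of `ρ(g) F₁ = F₁ ∣[2] g⁻¹` at `γ ∈ Γ̄(q)`: the period of `F₁` at `g⁻¹ γ g`.** [cite: ShimuraIATAF1971, §8.3 (8.3.2)] -/
theorem rePeriod_coverRep (F : CuspForm (principalLevel X q) 2) (g : coverUnits X q) (z₀ : UpperHalfPlane) (γ : principalLevel X q) :
    CuspForm.rePeriod (coverRep X q g F) z₀ γ =
      CuspForm.rePeriod F z₀ ⟨(g : GL (Fin 2) ℝ)⁻¹ * γ * g, by
        have h := (normal_principalLevel_subgroupOf X q).conj_mem ⟨γ, principalLevel_le_coverUnits X q γ.2⟩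
          (by rw [Subgroup.mem_subgroupOf]; exact γ.2) g⁻¹
        rw [Subgroup.mem_subgroupOf] at h
        simpa [mul_assoc] using h⟩ := by
  rw [CuspForm.rePeriod_apply, CuspForm.rePeriod_apply, coverRep_apply, coe_coverSlash,
    segmentIntegral_slash_eq F (det_pos_of_mem_coverUnits ((coverUnits X q).inv_mem g.2)) z₀ _]
  congr 1
  have hmem : (g : GL (Fin 2) ℝ)⁻¹ * γ * g ∈ principalLevel X q := by
    have h := (normal_principalLevel_subgroupOf X q).conj_mem ⟨γ, principalLevel_le_coverUnits X q γ.2⟩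
      (by rw [Subgroup.mem_subgroupOf]; exact γ.2) g⁻¹
    rw [Subgroup.mem_subgroupOf] at h
    simpa [mul_assoc] using h
  have h1 : ((g : GL (Fin 2) ℝ)⁻¹) • ((γ : GL (Fin 2) ℝ) • z₀) = ((g : GL (Fin 2) ℝ)⁻¹ * γ * g) • ((g : GL (Fin 2) ℝ)⁻¹ • z₀) := by
    simp only [mul_smul, smul_inv_smul]
  rw [h1]
  exact period_indep F hmem z₀ _

/-- An additive real cochain on a group is a class function: `u (g⁻¹ γ g) = u γ`. [folklore] -/
theorem addCochain_conj {G : Type*} [Group G] {u : G → ℝ} (hu : ∀ a b : G, u (a * b) = u a + u b) (g γ : G) :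
    u (g⁻¹ * γ * g) = u γ := by
  have h1 : u 1 = 0 := by have := hu 1 1; rw [mul_one] at this; linarith
  have hinv : u g⁻¹ = -u g := by have := hu g⁻¹ g; rw [inv_mul_cancel, h1] at this; linarith
  rw [hu, hu, hinv]; ring

/-- An additive real cochain on powers: `u (γ ^ n) = n • u γ`. [folklore] -/
theorem addCochain_pow {G : Type*} [Group G] {u : G → ℝ} (hu : ∀ a b : G, u (a * b) = u a + u b) (γ : G) (n : ℕ) :
    u (γ ^ n) = n * u γ := by
  have h1 : u 1 = 0 := by have := hu 1 1; rw [mul_one] at this; linarith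
  induction n with
  | zero => rw [pow_zero, h1, Nat.cast_zero, zero_mul]
  | succ n ih => rw [pow_succ, hu, ih, Nat.cast_succ]; ring

/-- Real periods of a finite sum of forms. -/
private theorem rePeriod_sum {Γ : Subgroup (GL (Fin 2) ℝ)} {ι : Type*} (s : Finset ι) (F : ι → CuspForm Γ 2) (z₀ : UpperHalfPlane) (γ : Γ) :
    CuspForm.rePeriod (∑ i ∈ s, F i) z₀ γ = ∑ i ∈ s, CuspForm.rePeriod (F i) z₀ γ := by
  classical
  induction s using Finset.induction_on with
  | empty =>
    rw [Finset.sum_empty, Finset.sum_empty]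
    have h := CuspForm.rePeriod_smul (0 : ℝ) (0 : CuspForm Γ 2) z₀ γ
    rw [zero_smul, zero_mul] at h
    exact h
  | insert i s hi ih => rw [Finset.sum_insert hi, Finset.sum_insert hi, CuspForm.rePeriod_add, ih]

/-- **ES-SURJECTIVITY DESCENDS FROM `Γ̄(q)` TO THE COVER GROUP.** If every additive `u₁ : Γ̄(q) → ℝ` is the real period cochain of some `F₁ ∈ S₂(Γ̄(q))`, then every
additive `u : ι(O₀'¹) → ℝ` is the real period cochain of some `F ∈ S₂(ι(O₀'¹))` — namely `[Γ':Γ̄(q)]⁻¹ · liftAvg F₁` for `F₁` realising `u|Γ̄(q)`. (At `D > 1` there are no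
parabolic elements, so this is exactly the surjectivity conjunct of (ESᶜ) at the cover group, granted the same conjunct on the torsion-free principal level.)
[cite: ShimuraIATAF1971, Thm. 8.4 p. 234 and §8.1 (8.1.2)–(8.1.3)] -/
theorem esSurj_coverUnits_of_esSurj_principalLevel (hq0 : q ≠ 0) (z₀ : UpperHalfPlane)
    (h₁ : ∀ u₁ : principalLevel X q → ℝ, (∀ γ δ : principalLevel X q, u₁ (γ * δ) = u₁ γ + u₁ δ) →
      ∃ F₁ : CuspForm (principalLevel X q) 2, ∀ γ : principalLevel X q, CuspForm.rePeriod F₁ z₀ γ = u₁ γ)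
    (u : coverUnits X q → ℝ) (hu : ∀ γ δ : coverUnits X q, u (γ * δ) = u γ + u δ) :
    ∃ F : CuspForm (coverUnits X q) 2, ∀ γ : coverUnits X q, CuspForm.rePeriod F z₀ γ = u γ := by
  classical
  letI := quotFintype (X := X) hq0
  haveI := finiteIndex_principalLevel_subgroupOf X q hq0
  haveI := normal_principalLevel_subgroupOf X q
  haveI : (coverUnits X q).HasDetOne := hasDetOne_normOneUnits X.ι (isOrder_coverOrder X q)
  -- restrict `u` to `Γ̄(q)` and realise it
  set u₁ : principalLevel X q → ℝ := fun γ => u ⟨γ, principalLevel_le_coverUnits X q γ.2⟩ with hu₁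
  obtain ⟨F₁, hF₁⟩ := h₁ u₁ fun γ δ => hu ⟨γ, principalLevel_le_coverUnits X q γ.2⟩ ⟨δ, principalLevel_le_coverUnits X q δ.2⟩
  -- periods of the average on `Γ̄(q)`: `[Γ':Γ̄(q)] · u`
  set N : ℕ := Fintype.card (coverUnits X q ⧸ (principalLevel X q).subgroupOf (coverUnits X q)) with hNdef
  have hN : 0 < N := Fintype.card_pos
  have havg : ∀ γ : principalLevel X q, CuspForm.rePeriod (avg hq0 F₁) z₀ γ = N * u ⟨γ, principalLevel_le_coverUnits X q γ.2⟩ := by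
    intro γ
    unfold avg
    rw [rePeriod_sum]
    have hterm : ∀ c : coverUnits X q ⧸ (principalLevel X q).subgroupOf (coverUnits X q),
        CuspForm.rePeriod (coverRep X q c.out F₁) z₀ γ = u ⟨γ, principalLevel_le_coverUnits X q γ.2⟩ := by
      intro c
      rw [rePeriod_coverRep, hF₁]
      have h := addCochain_conj hu c.out ⟨γ, principalLevel_le_coverUnits X q γ.2⟩
      rw [hu₁]
      convert h using 2
      exact Subtype.ext (by simp [mul_assoc])
    simp_rw [hterm]
    rw [Finset.sum_const, Finset.card_univ, nsmul_eq_mul]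
  -- the lifted, normalised form
  refine ⟨(N : ℝ)⁻¹ • liftAvg hq0 F₁, fun γ => ?_⟩
  rw [CuspForm.rePeriod_smul]
  -- `γ^N ∈ Γ̄(q)`
  have hγN : ((γ ^ ((principalLevel X q).subgroupOf (coverUnits X q)).index : coverUnits X q) : GL (Fin 2) ℝ) ∈ principalLevel X q := by
    have h := ((principalLevel X q).subgroupOf (coverUnits X q)).pow_index_mem γ
    rw [Subgroup.mem_subgroupOf] at h
    exact h
  have hidx : ((principalLevel X q).subgroupOf (coverUnits X q)).index = N := by
    rw [hNdef, Subgroup.index_eq_card, Nat.card_eq_fintype_card]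
  -- additivity of the periods of the lifted form on the cover group
  have hadd : ∀ a b : coverUnits X q, CuspForm.rePeriod (liftAvg hq0 F₁) z₀ (a * b) =
      CuspForm.rePeriod (liftAvg hq0 F₁) z₀ a + CuspForm.rePeriod (liftAvg hq0 F₁) z₀ b := CuspForm.rePeriod_mul _ z₀
  have hpow := addCochain_pow hadd γ N
  -- the period of the lifted form at `γ^N ∈ Γ̄(q)` is the period of `avg F₁` there
  have hper : CuspForm.rePeriod (liftAvg hq0 F₁) z₀ (γ ^ N) = N * (N * u γ) := by
    have h1 : CuspForm.rePeriod (liftAvg hq0 F₁) z₀ (γ ^ N) =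
        CuspForm.rePeriod (avg hq0 F₁) z₀ ⟨((γ ^ N : coverUnits X q) : GL (Fin 2) ℝ), hidx ▸ hγN⟩ := rfl
    rw [h1, havg]
    congr 1
    have h2 := addCochain_pow hu γ N
    convert h2 using 2
  have hNne : (N : ℝ) ≠ 0 := by exact_mod_cast hN.ne'
  have h3 : (N : ℝ) * CuspForm.rePeriod (liftAvg hq0 F₁) z₀ γ = N * (N * u γ) := by rw [← hpow, hper]
  have h4 : CuspForm.rePeriod (liftAvg hq0 F₁) z₀ γ = N * u γ := mul_left_cancel₀ hNne h3
  rw [h4, ← mul_assoc, inv_mul_cancel₀ hNne, one_mul]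

end Periods

end Summit.BirchSwinnertonDyer.BirchSwinnertonDyer.Theorems.CartanCover.PrintClauses

end
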